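import Literature.Probability.LatticeModels.CoarseGrainingLargeSets
import Literature.Probability.LatticeModels.LatticeAnimals
import Mathlib.Algebra.Order.Field.GeomSum
import HarnessLib

/-!
# Entropy of large connected fine polymers through a box (the large-set part of reblocking)

Complement to `CoarseGrainingLargeSets`: the weighted count of block-connected sets of fine
blocks (`IsBlockConnected`, `ℓ^∞`-touching on `ℤ^d`) of size at least `m ≥ 1` that meet a fixed
finite set `B` of fine blocks:

  `∑_{X ∈ 𝒳} Γ^{−|X|} ≤ 2 |B| ((3^d+1)²/Γ)^m`   for `Γ ≥ 2(3^d+1)²`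
  (`sum_inv_pow_card_le_of_blockConnected`),

for any finite family `𝒳` of such sets — from the tree's lattice-animal bound
`card_connectedFamily_le` (at most `(3^d+1)^{2n}` connected sets of size `≤ n+1` through a point,
neighbourhoods `blockTouchSet` of size `3^d`) and a geometric series. With `B = π⁻¹(u₀)` a coarse
block and the `η`-inequality `card_coarse_image_le_of_connected` (`(K+2)|π(X)| ≤ (K+1)|X|` for large
connected `X`) this is the large-set estimate of the reblocking step of a renormalisation-group map
(Brydges–Slade V, App. C): the total weight of the large connected fine polymers with a given
closure `U` decays faster than `Γ'^{−|U|}` per coarse block once `Γ` is large depending on `d` and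
`L` only. Also: every block of a connected set is within graph distance `|X| − 1` of any other
(`dist_le_card_sub_one`), so small connected sets have small closure
(`card_image_coarse_le_two_pow_of_blockConnected_small`).

## References

* D. C. Brydges, G. Slade, *A renormalisation group method. V. A single renormalisation group
  step*, J. Stat. Phys. 159 (2015) 589–667, App. C (Lemmas C.2, C.3). [BrydgesSlade2015RGV]
* S. Friedli, Y. Velenik, *Statistical Mechanics of Lattice Systems*, CUP 2017, Lemma 3.38 /
  (5.27) (counting connected sets). [FriedliVelenik2017]
-/

namespace Literature.Probability.LatticeModels

open Finset SimpleGraph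

variable {d : ℕ}

/-! ### Small connected sets have small closure -/

/-- In a block-connected set every block is within graph distance `|X| − 1` of any other.
[folklore] -/
theorem dist_le_card_sub_one {X : Finset (Fin d → ℤ)} (hconn : IsBlockConnected X) {a x : Fin d → ℤ}
    (ha : a ∈ X) (hx : x ∈ X) : (blockTouchGraph X).dist a x ≤ X.card - 1 := by
  classical
  have hball := min_le_card_ball hconn.2 ha (X.card - 1)
  have hpos : 1 ≤ X.card := card_pos.2 ⟨a, ha⟩
  rw [Nat.sub_add_cancel hpos, min_self] at hball
  have hsub : (X.filter fun y => (blockTouchGraph X).dist a y ≤ X.card - 1) ⊆ X := filter_subset _ _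
  have heq := eq_of_subset_of_card_le hsub hball
  have hx' : x ∈ X.filter fun y => (blockTouchGraph X).dist a y ≤ X.card - 1 := by rw [heq]; exact hx
  exact (mem_filter.1 hx').2

/-- **Small connected sets have small closure**: a block-connected set with at most `s` fine blocks,
`2(s−1) + 1 ≤ L_k`, meets at most `2^d` coarse blocks. [cite: BrydgesSlade2015RGV, §1.1 (small sets)] -/
theorem card_image_coarse_le_two_pow_of_blockConnected_small {L : Fin d → ℕ} {s : ℕ}
    (hL : ∀ k, 2 * (s - 1) + 1 ≤ L k) {X : Finset (Fin d → ℤ)} (hconn : IsBlockConnected X)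
    (hsmall : X.card ≤ s) : (X.image (coarse L)).card ≤ 2 ^ d := by
  obtain ⟨a, ha⟩ := hconn.1
  refine card_image_coarse_le_two_pow_of_diam (r := s - 1) hL a X fun x hx k => ?_
  have h1 := abs_sub_le_dist (hconn.2 a ha x hx) k
  have hlen : (blockTouchGraph X).dist a x ≤ s - 1 := (dist_le_card_sub_one hconn ha hx).trans (by omega)
  rw [abs_sub_comm] at h1
  exact h1.trans (by exact_mod_cast hlen)

/-! ### Counting block-connected sets through a point -/

/-- Reachability in the touching graph as a `ReflTransGen` chain of touching steps inside `X`
(the connectivity format of `LatticeAnimals.card_connectedFamily_le`). [folklore] -/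
theorem reflTransGen_of_reachable {X : Finset (Fin d → ℤ)} {v w : Fin d → ℤ}
    (h : (blockTouchGraph X).Reachable v w) :
    Relation.ReflTransGen (fun x y => BlockTouch x y ∧ x ∈ X ∧ y ∈ X) v w := by
  obtain ⟨p⟩ := h
  induction p with
  | nil => exact Relation.ReflTransGen.refl
  | cons h q ih => exact Relation.ReflTransGen.head ⟨h.2.2.2, h.2.1, h.2.2.1⟩ ih

/-- **At most `(3^d+1)^{2n}` block-connected sets of size `≤ n + 1` contain a given fine block**
(any finite family of them). [cite: FriedliVelenik2017, Lemma 3.38 / (5.27)] -/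
theorem card_blockConnected_family_le (v : Fin d → ℤ) (n : ℕ) (𝒮 : Finset (Finset (Fin d → ℤ)))
    (h𝒮 : ∀ S ∈ 𝒮, v ∈ S ∧ S.card ≤ n + 1 ∧ IsBlockConnected S) :
    𝒮.card ≤ (3 ^ d + 1) ^ (2 * n) := by
  refine card_connectedFamily_le (R := fun x y : Fin d → ℤ => BlockTouch x y) (nbr := blockTouchSet)
    (fun x y h => h.symm) (fun x => (card_blockTouchSet_eq x).le) (fun x y h => mem_blockTouchSet_of_blockTouch h.symm)
    v n 𝒮 fun S hS => ?_
  obtain ⟨hv, hcard, hconn⟩ := h𝒮 S hS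
  exact ⟨hv, hcard, fun w hw => reflTransGen_of_reachable (hconn.2 v hv w hw)⟩

/-- **Small sets have bounded multiplicity**: at most `(3^d+1)^{2(2^d−1)}` small
(`|X| ≤ 2^d`) block-connected sets contain a given fine block. [cite: BrydgesSlade2015RGV, §1.1 (small sets)] -/
theorem card_small_blockConnected_family_le (v : Fin d → ℤ) (𝒮 : Finset (Finset (Fin d → ℤ)))
    (h𝒮 : ∀ S ∈ 𝒮, v ∈ S ∧ S.card ≤ 2 ^ d ∧ IsBlockConnected S) :
    𝒮.card ≤ (3 ^ d + 1) ^ (2 * (2 ^ d - 1)) := by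
  refine card_blockConnected_family_le v (2 ^ d - 1) 𝒮 fun S hS => ?_
  obtain ⟨hv, hcard, hconn⟩ := h𝒮 S hS
  refine ⟨hv, ?_, hconn⟩
  have : 1 ≤ 2 ^ d := Nat.one_le_two_pow
  omega

/-! ### The weighted count -/

/-- **Entropy of large connected sets through a box.** Let `B` be a finite set of fine blocks and `𝒳`
a finite family of block-connected sets, each meeting `B` and of size at least `m ≥ 1`. Then for
`Γ ≥ 2(3^d+1)²`, `∑_{X ∈ 𝒳} Γ^{−|X|} ≤ 2|B|·((3^d+1)²/Γ)^m`.
[cite: BrydgesSlade2015RGV, App. C (Lemma C.2)] -/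
theorem sum_inv_pow_card_le_of_blockConnected (B : Finset (Fin d → ℤ)) (𝒳 : Finset (Finset (Fin d → ℤ)))
    {m : ℕ} (hm : 1 ≤ m) (h𝒳 : ∀ X ∈ 𝒳, IsBlockConnected X ∧ m ≤ X.card ∧ (X ∩ B).Nonempty)
    {Γ : ℝ} (hΓ : 2 * ((3 : ℝ) ^ d + 1) ^ 2 ≤ Γ) :
    ∑ X ∈ 𝒳, Γ⁻¹ ^ X.card ≤ 2 * B.card * ((((3 : ℝ) ^ d + 1) ^ 2) / Γ) ^ m := by
  classical
  set c : ℝ := ((3 : ℝ) ^ d + 1) ^ 2 with hc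
  set q : ℝ := c / Γ with hq
  have hc1 : 1 ≤ c := by
    rw [hc]; nlinarith [pow_nonneg (by norm_num : (0 : ℝ) ≤ 3) d, one_le_pow₀ (by norm_num : (1 : ℝ) ≤ 3) (n := d)]
  have hcpos : 0 < c := by linarith
  have hΓpos : 0 < Γ := by linarith
  have hq0 : 0 ≤ q := div_nonneg hcpos.le hΓpos.le
  have hqhalf : q ≤ 1 / 2 := by
    rw [hq, div_le_iff₀ hΓpos]; linarith
  have hq1 : q < 1 := by linarith
  -- sizes are bounded
  obtain ⟨N, hN⟩ : ∃ N, ∀ X ∈ 𝒳, X.card < N :=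
    ⟨(𝒳.sup card) + 1, fun X hX => Nat.lt_succ_of_le (le_sup (f := card) hX)⟩
  -- (1) distribute over the points of `B`: each `X` is counted at least once
  have h1 : ∑ X ∈ 𝒳, Γ⁻¹ ^ X.card ≤ ∑ v ∈ B, ∑ X ∈ 𝒳 with v ∈ X, Γ⁻¹ ^ X.card := by
    have hw : ∀ X ∈ 𝒳, Γ⁻¹ ^ X.card ≤ ∑ v ∈ B, if v ∈ X then Γ⁻¹ ^ X.card else 0 := by
      intro X hX
      obtain ⟨v, hv⟩ := (h𝒳 X hX).2.2
      rw [mem_inter] at hv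
      have hnn : ∀ w ∈ B, (0 : ℝ) ≤ if w ∈ X then Γ⁻¹ ^ X.card else 0 := fun w _ => by
        split_ifs <;> positivity
      calc Γ⁻¹ ^ X.card = if v ∈ X then Γ⁻¹ ^ X.card else 0 := by rw [if_pos hv.1]
        _ ≤ ∑ w ∈ B, if w ∈ X then Γ⁻¹ ^ X.card else 0 :=
            single_le_sum (f := fun w => if w ∈ X then Γ⁻¹ ^ X.card else 0) hnn hv.2
    calc ∑ X ∈ 𝒳, Γ⁻¹ ^ X.card ≤ ∑ X ∈ 𝒳, ∑ v ∈ B, if v ∈ X then Γ⁻¹ ^ X.card else 0 := sum_le_sum hw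
      _ = ∑ v ∈ B, ∑ X ∈ 𝒳, if v ∈ X then Γ⁻¹ ^ X.card else 0 := sum_comm
      _ = ∑ v ∈ B, ∑ X ∈ 𝒳 with v ∈ X, Γ⁻¹ ^ X.card := by
          refine sum_congr rfl fun v _ => ?_
          rw [sum_filter]
  -- (2) for a fixed point `v`: split by size and count
  have h2 : ∀ v ∈ B, ∑ X ∈ 𝒳 with v ∈ X, Γ⁻¹ ^ X.card ≤ 2 * q ^ m := by
    intro v _
    set 𝒴 := 𝒳.filter fun X => v ∈ X with h𝒴
    have hsplit : ∑ X ∈ 𝒴, Γ⁻¹ ^ X.card =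
        ∑ k ∈ Ico m N, ∑ X ∈ 𝒴 with X.card = k, Γ⁻¹ ^ X.card := by
      refine (sum_fiberwise_of_maps_to (g := card) (fun X hX => ?_) _).symm
      obtain ⟨hX𝒳, -⟩ := mem_filter.1 hX
      exact mem_Ico.2 ⟨(h𝒳 X hX𝒳).2.1, hN X hX𝒳⟩
    rw [hsplit]
    have hk : ∀ k ∈ Ico m N, ∑ X ∈ 𝒴 with X.card = k, Γ⁻¹ ^ X.card ≤ c ^ (k - 1) * Γ⁻¹ ^ k := by
      intro k hk
      have hkm : m ≤ k := (mem_Ico.1 hk).1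
      have hcount : (𝒴.filter fun X => X.card = k).card ≤ (3 ^ d + 1) ^ (2 * (k - 1)) := by
        refine card_blockConnected_family_le v (k - 1) _ fun S hS => ?_
        obtain ⟨hS𝒴, hSk⟩ := mem_filter.1 hS
        obtain ⟨hS𝒳, hvS⟩ := mem_filter.1 hS𝒴
        exact ⟨hvS, by omega, (h𝒳 S hS𝒳).1⟩
      calc ∑ X ∈ 𝒴 with X.card = k, Γ⁻¹ ^ X.card = ∑ X ∈ 𝒴 with X.card = k, Γ⁻¹ ^ k :=
            sum_congr rfl fun X hX => by rw [(mem_filter.1 hX).2]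
        _ = (𝒴.filter fun X => X.card = k).card * Γ⁻¹ ^ k := by rw [sum_const, nsmul_eq_mul]
        _ ≤ ((3 ^ d + 1) ^ (2 * (k - 1)) : ℕ) * Γ⁻¹ ^ k := by
            gcongr
        _ = c ^ (k - 1) * Γ⁻¹ ^ k := by
            rw [hc, ← pow_mul, mul_comm 2 (k - 1)]; push_cast; ring
    calc ∑ k ∈ Ico m N, ∑ X ∈ 𝒴 with X.card = k, Γ⁻¹ ^ X.card
        ≤ ∑ k ∈ Ico m N, c ^ (k - 1) * Γ⁻¹ ^ k := sum_le_sum hk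
      _ ≤ ∑ k ∈ Ico m N, q ^ k := by
          refine sum_le_sum fun k hk => ?_
          have hk1 : 1 ≤ k := hm.trans (mem_Ico.1 hk).1
          have : c ^ (k - 1) * Γ⁻¹ ^ k = q ^ k / c := by
            rw [hq, div_pow, inv_pow]
            have hck : c ^ k = c ^ (k - 1) * c := by rw [← pow_succ, Nat.sub_add_cancel hk1]
            rw [hck]
            field_simp
          rw [this]
          exact div_le_self (pow_nonneg hq0 k) hc1
      _ ≤ q ^ m / (1 - q) := geom_sum_Ico_le_of_lt_one hq0 hq1
      _ ≤ 2 * q ^ m := by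
          rw [div_le_iff₀ (by linarith)]
          nlinarith [pow_nonneg hq0 m]
  -- (3) assemble
  calc ∑ X ∈ 𝒳, Γ⁻¹ ^ X.card ≤ ∑ v ∈ B, ∑ X ∈ 𝒳 with v ∈ X, Γ⁻¹ ^ X.card := h1
    _ ≤ ∑ v ∈ B, 2 * q ^ m := sum_le_sum h2
    _ = 2 * B.card * q ^ m := by rw [sum_const, nsmul_eq_mul]; ring

/-- **The large-set estimate of reblocking.** Let `L_k ≥ 2^{d+1}+1`, `U` a finite set of coarse
blocks, `B` a finite set of fine blocks, and `𝒳` a finite family of LARGE (`|X| ≥ 2^d + 1`)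
block-connected fine polymers with closure `π(X) = U`, each meeting `B` (e.g. `B = π⁻¹(u₀)`,
`u₀ ∈ U`). By the `η`-inequality every `X ∈ 𝒳` has `(K+2)|U| ≤ (K+1)|X|`, `K = 2^d(3^d−1)`, so for
every `m ≥ 1` with `(K+1)m ≤ (K+2)|U|` the weighted count obeys
`∑_{X ∈ 𝒳} Γ^{−|X|} ≤ 2|B|((3^d+1)²/Γ)^m` (`Γ ≥ 2(3^d+1)²`) — decay in `|U|` at the improved rate
`m ≈ (K+2)|U|/(K+1)`. [cite: BrydgesSlade2015RGV, App. C (Lemmas C.2, C.3)] -/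
theorem sum_inv_pow_card_le_of_closure {L : Fin d → ℕ} (hL : ∀ k, 2 ^ (d + 1) + 1 ≤ L k)
    (U : Finset (Fin d → ℤ)) (B : Finset (Fin d → ℤ)) (𝒳 : Finset (Finset (Fin d → ℤ)))
    (h𝒳 : ∀ X ∈ 𝒳, IsBlockConnected X ∧ 2 ^ d + 1 ≤ X.card ∧ X.image (coarse L) = U ∧ (X ∩ B).Nonempty)
    {m : ℕ} (hm1 : 1 ≤ m) (hm : (2 ^ d * (3 ^ d - 1) + 1) * m ≤ (2 ^ d * (3 ^ d - 1) + 2) * U.card)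
    {Γ : ℝ} (hΓ : 2 * ((3 : ℝ) ^ d + 1) ^ 2 ≤ Γ) :
    ∑ X ∈ 𝒳, Γ⁻¹ ^ X.card ≤ 2 * B.card * ((((3 : ℝ) ^ d + 1) ^ 2) / Γ) ^ m := by
  refine sum_inv_pow_card_le_of_blockConnected B 𝒳 hm1 (fun X hX => ?_) hΓ
  obtain ⟨hconn, hlarge, hcl, hB⟩ := h𝒳 X hX
  refine ⟨hconn, ?_, hB⟩
  have h := card_coarse_image_le_of_connected hL hconn hlarge
  rw [hcl] at h
  -- `(K+1) m ≤ (K+2)|U| ≤ (K+1)|X|` gives `m ≤ |X|`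
  exact Nat.le_of_mul_le_mul_left (hm.trans h) (Nat.succ_pos _)

end Literature.Probability.LatticeModels
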